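import Summits.SmoothPoincare4.SmoothPoincare4.Theorems.ConvexBisectionAcyclicBisectionExistsOrseamSeamFrames
import Literature.Topology.FourManifolds.BoundaryOrientation
import Mathlib.LinearAlgebra.Alternating.Curry
import HarnessLib

/-!
# Dual handles, ORSEAM: the orientation character of the seam at a point does not depend on the frames
(sub-goal ORSEAM of stub `stub_T3_dualPresentation` (T3), line `modp-braid-orbits` r12, crux
`ConvexBisection.AcyclicBisectionExists`, item stmt-SmoothPoincare4-10508; wave 5, lead c5, worker X4;
registered sub-goal `helper_orientationCharacter_of_frame`)

Sequel of `…OrseamSeamFrames.lean`.  The SIGN-PIN + ORSEAM assembly (`helper_dualPresentation_signPin`,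
`…OrseamSignPin.lean`) takes the orientation character of the seam correspondence at the seam point in
the ∀-form "for ALL corresponding frames `(uu, v₁, v₂)`, side 1 positive ⇒ `ε ·` side 2 positive".
Here this is reduced to ONE frame computation:

* §1 `exists_seamDifferential`: at a seam point the correspondence `v₁ ↦ v₂` of the frame clauses
  (`d(b₁.incl) uu = d(D₁.jA) v₁`, `d(b₂.incl ∘ φ) uu = d(D₂.jA) v₂`) is ONE linear map
  `T = d(D₂.jA)⁻¹ ∘ d(b₂.incl ∘ φ) ∘ L ∘ d(D₁.jA)` (`L` a linear left inverse of `d(b₁.incl)`).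
* §2 `orientationCharacter_of_frame` (registered as `helper_orientationCharacter_of_frame`): the two
  functions `v ↦ det4 (∇rho a₁, ambient v)` and `v ↦ det4 (∇rho a₂, ambient (T v))` are alternating
  `3`-forms on the boundary hyperplane `{v₀ = 0} ≅ ℝ³`, hence proportional
  (`AlternatingMap.eq_smul_basis_det`); so if ONE triple of corresponding frames has side 1 positive and
  `ε ·` side 2 positive, then EVERY triple with side 1 positive has `ε ·` side 2 positive.

Everything is proved; no named facts, no `sorry`.

## References
* R. İ. Baykur, *Kähler decomposition of 4-manifolds*, AGT 6 (2006), §2.3. [Baykur2006]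
* J. M. Lee, *Introduction to Smooth Manifolds* (2013), Prop. 15.24. [LeeSmoothManifolds2013]
-/

noncomputable section

-- the prescribed namespace `Summit.<P>.<Sub>.…` duplicates `SmoothPoincare4` (P = Sub)
set_option linter.dupNamespace false

open scoped Manifold ContDiff Topology RealInnerProductSpace

namespace Summit.SmoothPoincare4.SmoothPoincare4.Theorems.AcyclicBisectionExists.ModpBraidOrbits

open Set Function Metric Module
open Literature.Topology.FourManifolds Literature.Topology.FourManifolds.HandleAttachingMap
  Literature.Topology.FourManifolds.BoundaryManifold Literature.Topology.FourManifolds.LefschetzBase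
  Literature.Geometry.Symplectic Literature.Geometry.Manifold

section Character

variable {g : ℕ}
  {X₁ : Type*} [TopologicalSpace X₁] [ChartedSpace (EuclideanHalfSpace 4) X₁]
  [IsManifold (𝓡∂ 4) ∞ X₁] {ι₁ : Type*} [Finite ι₁] {q₁ : ι₁ → HandleAttachingMap 3 2 (Base g)}
  {W₂ : Type*} [TopologicalSpace W₂] [ChartedSpace (EuclideanHalfSpace 4) W₂]
  [IsManifold (𝓡∂ 4) ∞ W₂] {ι₂ : Type*} [Finite ι₂] {q₂ : ι₂ → HandleAttachingMap 3 2 (Base g)}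

/-! ## §1 The seam differential -/

/-- **The seam differential.**  At a seam point the frame correspondence `(uu, v₁, v₂)`
(`d(b₁.incl)_{y₀} uu = d(D₁.jA)_{a₁} v₁`, `d(b₂.incl ∘ φ)_{y₀} uu = d(D₂.jA)_{a₂} v₂`) is the graph of ONE
linear map: `v₂ = T v₁` with `T = d(D₂.jA)⁻¹ ∘ d(b₂.incl ∘ φ) ∘ L ∘ d(D₁.jA)`, `L` a linear left inverse
of the injective `d(b₁.incl)`. [cite: LeeSmoothManifolds2013, Thm. 5.11] -/
theorem exists_seamDifferential (D₁ : MultiAttachmentData q₁ (𝓡∂ 4) X₁) (b₁ : BoundaryData (𝓡∂ 4) X₁ (𝓡 3))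
    (D₂ : MultiAttachmentData q₂ (𝓡∂ 4) W₂) (b₂ : BoundaryData (𝓡∂ 4) W₂ (𝓡 3))
    (φ : b₁.carrier ≃ₘ⟮𝓡 3, 𝓡 3⟯ b₂.carrier) (y₀ : b₁.carrier) (a₁ : ↥(coresComplement q₁))
    (a₂ : ↥(coresComplement q₂)) :
    ∃ T : EuclideanSpace ℝ (Fin 4) →ₗ[ℝ] EuclideanSpace ℝ (Fin 4),
      ∀ (u : EuclideanSpace ℝ (Fin 3)) (v w : EuclideanSpace ℝ (Fin 4)),
        mfderiv (𝓡 3) (𝓡∂ 4) b₁.incl y₀ u = mfderiv (𝓡∂ 4) (𝓡∂ 4) D₁.jA a₁ v →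
        mfderiv (𝓡 3) (𝓡∂ 4) (b₂.incl ∘ φ) y₀ u = mfderiv (𝓡∂ 4) (𝓡∂ 4) D₂.jA a₂ w → w = T v := by
  set R := b₁.restrictDiffeomorph (BoundaryManifold.boundaryData 3 X₁) (Diffeomorph.refl (𝓡∂ 4) X₁ ∞) with hR
  set E := R.mfderivToContinuousLinearEquiv (by simp) y₀ with hE
  set J₁ : EuclideanSpace ℝ (Fin 4) →L[ℝ] EuclideanSpace ℝ (Fin 4) := mfderiv (𝓡∂ 4) (𝓡∂ 4) D₁.jA a₁ with hJ₁
  set J₂ : EuclideanSpace ℝ (Fin 4) →L[ℝ] EuclideanSpace ℝ (Fin 4) := mfderiv (𝓡∂ 4) (𝓡∂ 4) D₂.jA a₂ with hJ₂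
  set Bφ : EuclideanSpace ℝ (Fin 3) →L[ℝ] EuclideanSpace ℝ (Fin 4) := mfderiv (𝓡 3) (𝓡∂ 4) (b₂.incl ∘ φ) y₀
    with hBφ
  have hbij : Bijective J₂.toLinearMap := ⟨injective_mfderiv_jA D₂ a₂, surjective_mfderiv_jA D₂ a₂⟩
  set J₂e := LinearEquiv.ofBijective J₂.toLinearMap hbij with hJ₂e
  set L : EuclideanSpace ℝ (Fin 4) →ₗ[ℝ] EuclideanSpace ℝ (Fin 3) :=
    E.symm.toLinearEquiv.toLinearMap ∘ₗ (tailL 3).toLinearMap with hL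
  refine ⟨J₂e.symm.toLinearMap ∘ₗ Bφ.toLinearMap ∘ₗ L ∘ₗ J₁.toLinearMap, fun u v w hF1 hF2 => ?_⟩
  -- `L` is a left inverse of `d(b₁.incl) = (0, ·) ∘ dR`
  have hLB : ∀ u' : EuclideanSpace ℝ (Fin 3), L (mfderiv (𝓡 3) (𝓡∂ 4) b₁.incl y₀ u') = u' := fun u' => by
    rw [(hasMFDerivAt_incl_boundaryData' b₁ y₀).mfderiv]
    show E.symm (tail 3 (consZeroL 3 (mfderiv (𝓡 3) (𝓡 3) R y₀ u'))) = u'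
    rw [tail_consZeroL]
    exact E.symm_apply_apply u'
  have hu : u = L (J₁ v) := by
    rw [← hLB u, hF1]
    rfl
  have hw : w = J₂e.symm (Bφ u) := by
    apply J₂e.injective
    rw [LinearEquiv.apply_symm_apply, LinearEquiv.ofBijective_apply]
    exact hF2.symm
  rw [hw, hu]
  rfl

/-! ## §2 One frame computation decides the orientation character -/

/-- The boundary hyperplane `{v₀ = 0}` of `ℝ⁴` is `ℝ³`: `tail` restricted to it is a linear
isomorphism (inverse `(0, ·)`). [folklore] -/
theorem bijective_tail_boundaryTangentSpace :
    Bijective ((tailL 3).toLinearMap.domRestrict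
      (boundaryTangentSpace : Submodule ℝ (EuclideanSpace ℝ (Fin 4)))) := by
  constructor
  · intro x y hxy
    apply Subtype.ext
    have hx : consZeroL 3 (tail 3 (x : EuclideanSpace ℝ (Fin 4))) = x :=
      consCLE_tail_of_eq_zero 3 ((mem_boundaryTangentSpace_iff _).1 x.2)
    have hy : consZeroL 3 (tail 3 (y : EuclideanSpace ℝ (Fin 4))) = y :=
      consCLE_tail_of_eq_zero 3 ((mem_boundaryTangentSpace_iff _).1 y.2)
    have h' : tail 3 (x : EuclideanSpace ℝ (Fin 4)) = tail 3 (y : EuclideanSpace ℝ (Fin 4)) := hxy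
    rw [← hx, ← hy, h']
  · intro u
    refine ⟨⟨consZeroL 3 u, (mem_boundaryTangentSpace_iff _).2 (consZeroL_apply_zero u)⟩, ?_⟩
    show tail 3 (consZeroL 3 u) = u
    exact tail_consZeroL u

/-- **One frame computation decides the orientation character of the seam at a point.**  At a seam
point `b₁.incl y₀ = D₁.jA a₁`, `b₂.incl (φ y₀) = D₂.jA a₂`, suppose ONE triple of corresponding frames
`(uu⁰, v₁⁰, v₂⁰)` has side 1 positive (`IsPosBdryFrame q₁ a₁ v₁⁰`) and `ε · det4 (∇rho a₂, ambientC v₂⁰) > 0`.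
Then EVERY triple of corresponding frames with side 1 positive has `ε · det4 (∇rho a₂, ambientC v₂) > 0`:
corresponding frames are related by the fixed seam differential `T` (`exists_seamDifferential`), and
`v ↦ det4 (∇rho a₁, ambient v)`, `v ↦ det4 (∇rho a₂, ambient (T v))` are proportional alternating `3`-forms
on the boundary hyperplane. [cite: Baykur2006, §2.3] -/
theorem orientationCharacter_of_frame (D₁ : MultiAttachmentData q₁ (𝓡∂ 4) X₁)
    (b₁ : BoundaryData (𝓡∂ 4) X₁ (𝓡 3)) (D₂ : MultiAttachmentData q₂ (𝓡∂ 4) W₂)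
    (b₂ : BoundaryData (𝓡∂ 4) W₂ (𝓡 3)) (φ : b₁.carrier ≃ₘ⟮𝓡 3, 𝓡 3⟯ b₂.carrier) (y₀ : b₁.carrier)
    (a₁ : ↥(coresComplement q₁)) (a₂ : ↥(coresComplement q₂)) (h₁ : b₁.incl y₀ = D₁.jA a₁)
    (ε : ℝ) (uu₀ : Fin 3 → EuclideanSpace ℝ (Fin 3)) (v₁₀ v₂₀ : Fin 3 → EuclideanSpace ℝ (Fin 4))
    (hF1₀ : ∀ k, mfderiv (𝓡 3) (𝓡∂ 4) b₁.incl y₀ (uu₀ k) = mfderiv (𝓡∂ 4) (𝓡∂ 4) D₁.jA a₁ (v₁₀ k))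
    (hF2₀ : ∀ k, mfderiv (𝓡 3) (𝓡∂ 4) (b₂.incl ∘ φ) y₀ (uu₀ k) = mfderiv (𝓡∂ 4) (𝓡∂ 4) D₂.jA a₂ (v₂₀ k))
    (hpos₀ : IsPosBdryFrame q₁ a₁ v₁₀)
    (hε₀ : 0 < ε * det4 (gradient (rho g) (a₂ : Base g).1) (ambientC q₂ a₂ (v₂₀ 0))
      (ambientC q₂ a₂ (v₂₀ 1)) (ambientC q₂ a₂ (v₂₀ 2)))
    (uu : Fin 3 → EuclideanSpace ℝ (Fin 3)) (v₁ v₂ : Fin 3 → EuclideanSpace ℝ (Fin 4))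
    (hF1 : ∀ k, mfderiv (𝓡 3) (𝓡∂ 4) b₁.incl y₀ (uu k) = mfderiv (𝓡∂ 4) (𝓡∂ 4) D₁.jA a₁ (v₁ k))
    (hF2 : ∀ k, mfderiv (𝓡 3) (𝓡∂ 4) (b₂.incl ∘ φ) y₀ (uu k) = mfderiv (𝓡∂ 4) (𝓡∂ 4) D₂.jA a₂ (v₂ k))
    (hpos : IsPosBdryFrame q₁ a₁ v₁) :
    0 < ε * det4 (gradient (rho g) (a₂ : Base g).1) (ambientC q₂ a₂ (v₂ 0)) (ambientC q₂ a₂ (v₂ 1))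
      (ambientC q₂ a₂ (v₂ 2)) := by
  have ha₁ := (rho_eq_of_incl_eq_jA D₁ b₁ h₁).1
  -- all `v₁`'s are tangent to the boundary
  have htan : ∀ (u : Fin 3 → EuclideanSpace ℝ (Fin 3)) (v : Fin 3 → EuclideanSpace ℝ (Fin 4)),
      (∀ k, mfderiv (𝓡 3) (𝓡∂ 4) b₁.incl y₀ (u k) = mfderiv (𝓡∂ 4) (𝓡∂ 4) D₁.jA a₁ (v k)) →
      ∀ k, v k ∈ (boundaryTangentSpace : Submodule ℝ (EuclideanSpace ℝ (Fin 4))) := fun u v hu k =>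
    mem_boundaryTangentSpace_of_mfderiv_jA D₁ a₁ ha₁
      (by rw [← hu k]; exact mfderiv_incl_mem_boundaryTangentSpace b₁ y₀ (u k))
  have hV₀ := htan uu₀ v₁₀ hF1₀
  have hV := htan uu v₁ hF1
  -- the seam differential
  obtain ⟨T, hT⟩ := exists_seamDifferential D₁ b₁ D₂ b₂ φ y₀ a₁ a₂
  have hv₂₀ : ∀ k, v₂₀ k = T (v₁₀ k) := fun k => hT _ _ _ (hF1₀ k) (hF2₀ k)
  have hv₂ : ∀ k, v₂ k = T (v₁ k) := fun k => hT _ _ _ (hF1 k) (hF2 k)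
  -- the ambient readings as linear maps
  obtain ⟨amb₁, hamb₁⟩ : ∃ A : EuclideanSpace ℝ (Fin 4) →ₗ[ℝ] EuclideanSpace ℝ (Fin 4),
      ∀ v, ambientC q₁ a₁ v = A v :=
    ⟨(mfderiv (𝓡∂ 4) (𝓡 4) (RegularSublevel.incl (isRegularLevel_rho g)) (a₁ : Base g)).toLinearMap,
      fun v => (ambientC_eq_ambient q₁ a₁ v).trans rfl⟩
  obtain ⟨amb₂, hamb₂⟩ : ∃ A : EuclideanSpace ℝ (Fin 4) →ₗ[ℝ] EuclideanSpace ℝ (Fin 4),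
      ∀ v, ambientC q₂ a₂ v = A v :=
    ⟨(mfderiv (𝓡∂ 4) (𝓡 4) (RegularSublevel.incl (isRegularLevel_rho g)) (a₂ : Base g)).toLinearMap,
      fun v => (ambientC_eq_ambient q₂ a₂ v).trans rfl⟩
  -- the two alternating `3`-forms on the boundary hyperplane `S`
  obtain ⟨ω₁, hω₁⟩ : ∃ frm : ↥(boundaryTangentSpace : Submodule ℝ (EuclideanSpace ℝ (Fin 4))) [⋀^Fin 3]→ₗ[ℝ] ℝ,
      ∀ v : Fin 3 → ↥(boundaryTangentSpace : Submodule ℝ (EuclideanSpace ℝ (Fin 4))),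
        frm v = det4 (gradient (rho g) (a₁ : Base g).1) (amb₁ (v 0)) (amb₁ (v 1)) (amb₁ (v 2)) :=
    ⟨(((PiLp.basisFun 2 ℝ (Fin 4)).det.curryLeft (gradient (rho g) (a₁ : Base g).1)).compLinearMap
        (amb₁ ∘ₗ (boundaryTangentSpace : Submodule ℝ (EuclideanSpace ℝ (Fin 4))).subtype)), fun v => by
      rw [AlternatingMap.compLinearMap_apply, AlternatingMap.curryLeft_apply_apply, det4_eq_basis_det]
      congr 1
      funext i; fin_cases i <;> rfl⟩
  obtain ⟨ω₂, hω₂⟩ : ∃ frm : ↥(boundaryTangentSpace : Submodule ℝ (EuclideanSpace ℝ (Fin 4))) [⋀^Fin 3]→ₗ[ℝ] ℝ,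
      ∀ v : Fin 3 → ↥(boundaryTangentSpace : Submodule ℝ (EuclideanSpace ℝ (Fin 4))),
        frm v = det4 (gradient (rho g) (a₂ : Base g).1) (amb₂ (T (v 0))) (amb₂ (T (v 1))) (amb₂ (T (v 2))) :=
    ⟨(((PiLp.basisFun 2 ℝ (Fin 4)).det.curryLeft (gradient (rho g) (a₂ : Base g).1)).compLinearMap
        (amb₂ ∘ₗ T ∘ₗ (boundaryTangentSpace : Submodule ℝ (EuclideanSpace ℝ (Fin 4))).subtype)), fun v => by
      rw [AlternatingMap.compLinearMap_apply, AlternatingMap.curryLeft_apply_apply, det4_eq_basis_det]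
      congr 1
      funext i; fin_cases i <;> rfl⟩
  -- a basis of `S ≅ ℝ³`: the two forms are proportional
  obtain ⟨bS⟩ : Nonempty (Basis (Fin 3) ℝ ↥(boundaryTangentSpace : Submodule ℝ (EuclideanSpace ℝ (Fin 4)))) :=
    ⟨(PiLp.basisFun 2 ℝ (Fin 3)).map (LinearEquiv.ofBijective _ bijective_tail_boundaryTangentSpace).symm⟩
  have k₁ : ∀ v, ω₁ v = ω₁ bS * bS.det v := fun v =>
    calc ω₁ v = (ω₁ bS • bS.det) v := by rw [← ω₁.eq_smul_basis_det bS]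
      _ = ω₁ bS * bS.det v := rfl
  have k₂ : ∀ v, ω₂ v = ω₂ bS * bS.det v := fun v =>
    calc ω₂ v = (ω₂ bS • bS.det) v := by rw [← ω₂.eq_smul_basis_det bS]
      _ = ω₂ bS * bS.det v := rfl
  -- evaluate the forms on the two frames
  have e₁₀ : ω₁ (fun k => ⟨v₁₀ k, hV₀ k⟩) = det4 (gradient (rho g) (a₁ : Base g).1)
      (ambientC q₁ a₁ (v₁₀ 0)) (ambientC q₁ a₁ (v₁₀ 1)) (ambientC q₁ a₁ (v₁₀ 2)) := by
    rw [hω₁, hamb₁, hamb₁, hamb₁]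
  have e₁ : ω₁ (fun k => ⟨v₁ k, hV k⟩) = det4 (gradient (rho g) (a₁ : Base g).1)
      (ambientC q₁ a₁ (v₁ 0)) (ambientC q₁ a₁ (v₁ 1)) (ambientC q₁ a₁ (v₁ 2)) := by
    rw [hω₁, hamb₁, hamb₁, hamb₁]
  have e₂₀ : ω₂ (fun k => ⟨v₁₀ k, hV₀ k⟩) = det4 (gradient (rho g) (a₂ : Base g).1)
      (ambientC q₂ a₂ (v₂₀ 0)) (ambientC q₂ a₂ (v₂₀ 1)) (ambientC q₂ a₂ (v₂₀ 2)) := by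
    rw [hω₂, hamb₂, hamb₂, hamb₂, hv₂₀, hv₂₀, hv₂₀]
  have e₂ : ω₂ (fun k => ⟨v₁ k, hV k⟩) = det4 (gradient (rho g) (a₂ : Base g).1)
      (ambientC q₂ a₂ (v₂ 0)) (ambientC q₂ a₂ (v₂ 1)) (ambientC q₂ a₂ (v₂ 2)) := by
    rw [hω₂, hamb₂, hamb₂, hamb₂, hv₂, hv₂, hv₂]
  have hp₀ : 0 < ω₁ (fun k => ⟨v₁₀ k, hV₀ k⟩) := by rw [e₁₀]; exact hpos₀
  have hp : 0 < ω₁ (fun k => ⟨v₁ k, hV k⟩) := by rw [e₁]; exact hpos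
  have hq₀ : 0 < ε * ω₂ (fun k => ⟨v₁₀ k, hV₀ k⟩) := by rw [e₂₀]; exact hε₀
  rw [← e₂]
  -- `ε ω₂(V) ω₁(V₀) = ε ω₂(V₀) ω₁(V)`
  have key : (ε * ω₂ (fun k => ⟨v₁ k, hV k⟩)) * ω₁ (fun k => ⟨v₁₀ k, hV₀ k⟩) =
      (ε * ω₂ (fun k => ⟨v₁₀ k, hV₀ k⟩)) * ω₁ (fun k => ⟨v₁ k, hV k⟩) := by
    rw [k₁ (fun k => ⟨v₁ k, hV k⟩), k₁ (fun k => ⟨v₁₀ k, hV₀ k⟩), k₂ (fun k => ⟨v₁ k, hV k⟩),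
      k₂ (fun k => ⟨v₁₀ k, hV₀ k⟩)]
    ring
  have hprod : 0 < (ε * ω₂ (fun k => ⟨v₁ k, hV k⟩)) * ω₁ (fun k => ⟨v₁₀ k, hV₀ k⟩) := by
    rw [key]; exact mul_pos hq₀ hp
  exact (mul_pos_iff_of_pos_right hp₀).1 hprod

end Character

/-! ## §3 The registered package -/

/-- **Sub-goal `helper_orientationCharacter_of_frame` of stub `stub_T3_dualPresentation`** (T3 ▸ ORSEAM;
wave 5, lead c5, worker X4): **one frame computation decides the orientation character of the seam at a
point** — if ONE triple of corresponding frames at the seam point `b₁.incl y₀ = D₁.jA a₁` has side 1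
positive and `ε · det4` of side 2 positive, then EVERY triple of corresponding frames with side 1 positive
has `ε · det4` of side 2 positive (the hypothesis `Hχ` of `helper_dualPresentation_signPin` with
`ε = if s then 1 else -1` follows from a single computation). [cite: Baykur2006, §2.3] -/
theorem helper_orientationCharacter_of_frame : ∀ (g : ℕ) (X₁ : Type) [TopologicalSpace X₁] [ChartedSpace (EuclideanHalfSpace 4) X₁] [IsManifold (𝓡∂ 4) ∞ X₁] (ι₁ : Type) [Finite ι₁] (q₁ : ι₁ → Literature.Topology.FourManifolds.HandleAttachingMap 3 2 (Literature.Topology.FourManifolds.LefschetzBase.Base g)) (W₂ : Type) [TopologicalSpace W₂] [ChartedSpace (EuclideanHalfSpace 4) W₂] [IsManifold (𝓡∂ 4) ∞ W₂] (ι₂ : Type) [Finite ι₂] (q₂ : ι₂ → Literature.Topology.FourManifolds.HandleAttachingMap 3 2 (Literature.Topology.FourManifolds.LefschetzBase.Base g)) (D₁ : Literature.Topology.FourManifolds.HandleAttachingMap.MultiAttachmentData q₁ (𝓡∂ 4) X₁) (b₁ : Literature.Topology.FourManifolds.BoundaryData (𝓡∂ 4) X₁ (𝓡 3)) (D₂ :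 Literature.Topology.FourManifolds.HandleAttachingMap.MultiAttachmentData q₂ (𝓡∂ 4) W₂) (b₂ : Literature.Topology.FourManifolds.BoundaryData (𝓡∂ 4) W₂ (𝓡 3)) (φ : b₁.carrier ≃ₘ⟮𝓡 3, 𝓡 3⟯ b₂.carrier) (y₀ : b₁.carrier) (a₁ : Literature.Topology.FourManifolds.HandleAttachingMap.coresComplement q₁) (a₂ : Literature.Topology.FourManifolds.HandleAttachingMap.coresComplement q₂) (ε : ℝ) (uu₀ : Fin 3 → EuclideanSpace ℝ (Fin 3)) (v₁₀ v₂₀ : Fin 3 → EuclideanSpace ℝ (Fin 4)) (uu : Fin 3 → EuclideanSpace ℝ (Fin 3)) (v₁ v₂ : Fin 3 → EuclideanSpace ℝ (Fin 4)), b₁.incl y₀ = D₁.jA a₁ → (∀ k, mfderiv (𝓡 3) (𝓡∂ 4) b₁.incl y₀ (uu₀ k) = mfderiv (𝓡∂ 4) (𝓡∂ 4) D₁.jA a₁ (v₁₀ k)) → (∀ k, mfderiv (𝓡 3) (𝓡∂ 4) (b₂.incl ∘ φ) y₀ (uu₀ k) = mfderiv (𝓡∂ 4) (𝓡∂ 4)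 D₂.jA a₂ (v₂₀ k)) → Literature.Geometry.Symplectic.IsPosBdryFrame q₁ a₁ v₁₀ → 0 < ε * Literature.Geometry.Symplectic.det4 (gradient (Literature.Topology.FourManifolds.LefschetzBase.rho g) a₂.1.1) (Literature.Geometry.Symplectic.ambientC q₂ a₂ (v₂₀ 0)) (Literature.Geometry.Symplectic.ambientC q₂ a₂ (v₂₀ 1)) (Literature.Geometry.Symplectic.ambientC q₂ a₂ (v₂₀ 2)) → (∀ k, mfderiv (𝓡 3) (𝓡∂ 4) b₁.incl y₀ (uu k) = mfderiv (𝓡∂ 4) (𝓡∂ 4) D₁.jA a₁ (v₁ k)) → (∀ k, mfderiv (𝓡 3) (𝓡∂ 4) (b₂.incl ∘ φ) y₀ (uu k) = mfderiv (𝓡∂ 4) (𝓡∂ 4) D₂.jA a₂ (v₂ k)) → Literature.Geometry.Symplectic.IsPosBdryFrame q₁ a₁ v₁ → 0 < ε * Literature.Geometry.Symplectic.det4 (gradient (Literature.Topology.FourManifolds.LefschetzBase.rho g) a₂.1.1) (Literature.Geometry.Symplectic.ambientC q₂ a₂ (v₂ 0)) (Literature.Geometry.Symplectic.ambientC q₂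 a₂ (v₂ 1)) (Literature.Geometry.Symplectic.ambientC q₂ a₂ (v₂ 2)) :=
  fun _ _ _ _ _ _ _ _ _ _ _ _ _ _ _ D₁ b₁ D₂ b₂ φ y₀ a₁ a₂ ε uu₀ v₁₀ v₂₀ uu v₁ v₂ h₁ hF1₀ hF2₀ hpos₀ hε₀ hF1 hF2 hpos =>
    orientationCharacter_of_frame D₁ b₁ D₂ b₂ φ y₀ a₁ a₂ h₁ ε uu₀ v₁₀ v₂₀ hF1₀ hF2₀ hpos₀ hε₀ uu v₁ v₂ hF1 hF2 hpos

end Summit.SmoothPoincare4.SmoothPoincare4.Theorems.AcyclicBisectionExists.ModpBraidOrbits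

end
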